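import Summits.QuantumFields.YangMills.Theorems.MirrorModularBoostsCurvatureBoostCovarianceRayPositivityCore

/-!
# Ray positivity of the doubled pencils, II: boosts inherit the mirrors — stub `stub_rayPositivity`

Line `boosts-inherit-mirrors` of crux `MirrorModularBoosts.CurvatureBoostCovariance`
(stmt-QuantumFields-9663), Stub 4 of the registered skeleton
`Cruxes/CurvatureBoostCovariance/Lines/boosts_inherit_mirrors.lean` in its second reshape (ledger
registry of stmt-QuantumFields-9663, skeleton sha `e63ce4901234`, nine stubs), which splits the
original Stub 4 into the analytic input Stub 4a `stub_planarBoostVectors` (boosted OS vectors; open),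
the core Stub 4b `stub_rayPositivityCore` (landed in
`MirrorModularBoostsCurvatureBoostCovarianceRayPositivityCore.lean`, imported here) and the present
Stub 4, whose registered statement carries the statement of Stub 4a as its first hypothesis.

Statement (`stub_rayPositivity`, the registered signature verbatim).  HYPOTHESIS — verbatim the
statement of the registered input Stub 4a `stub_planarBoostVectors` (boosted OS vectors), which is
NOT proved here: for every one-species family with E2 along `e₀` + translations
(`h : OSReconstructionNoE1`), E0', E3, the eight planar frames and the planar cone, and every
compactly supported `e₀`-time-ordered `F`, there are `ε > 0` and `V : ℂ → h.Hilbert` holomorphic on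
the strip `{|Re θ| < ε}`, of exponential type in `Im θ`, with `V θ = Ψ_{R_θ F}` for real `|θ| < ε`
(`R_θ = planeRot 0 θ`).  CONCLUSION: for a one-species family `S₁` on `ℝ⁴` with the OS package,
translations on `⁰𝒮`, reflection positivity in the eight planar frames, the planar cone, and the
planar-cone theorem for eight-frame families (`PlanarSpectralCone`, used for the `45°` pull-back),
for compactly supported `e₀`-time-ordered `F` (degree `n`) and `G` (degree `m`) with witnesses
`HFF, HFG, HGF, HGG` of the doubled blocks `ΘF*⊗F, ΘF*⊗G, ΘG*⊗F, ΘG*⊗G` whose orbit functions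
`θ ↦ 𝔖(R_θ H)` are trigonometric polynomials in `e^{4iθ}` with coefficients `p, q, q', r`: for
every real `s ≠ 0` and all `v, w ∈ ℂ` the `2 × 2` Laurent pencil
`v̄v P(s) + v̄w Q(s) + w̄v Q'(s) + w̄w R(s)` is real and `≥ 0`.
Thus Stub 4 is closed MODULO the registered input `stub_planarBoostVectors`.

Proof outline.
* `s > 0` (`axis_half`, for a general family `S'` with E2 along `e₀` + translations, E0', E3, eight
  frames and cone): the hypothesis gives `ε > 0` and `V_F, V_G` holomorphic on the strip with
  `V_•(θ) = Ψ_{R_θ •}` for real `|θ| < ε`; shrink `ε` below the rotation margins of the two compact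
  supports (`exists_isTimeOrdered_planeRot`).  Since `R_θ(ΘF* ⊗ G) = Θ(R_{-θ}F)* ⊗ R_θ G`,
  `inner_fieldVec_fieldVec` gives `𝔖(R_θ H_{FG}) = ⟪V_F(-θ), V_G(θ)⟫` on the real segment
  (`orbit_eq_inner`), and `stub_rayPositivityCore` (Gram form at the imaginary angle) concludes.
* `s < 0`: the same for the pull-back `T = 𝔖 ∘ (R_{π/4} ·)`, which is `e₀`-reflection positive
  (`EightFrameRP` at the frame `R_{π/4}`: `R_{π/4} e₀ = (e₀ - e₁)/√2`), inherits E0' (Schwartz norms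
  are invariant under the diagonal isometry), E3, translations and the eight frames (`R_{π/4}`
  permutes the eight normals), hence has the planar cone by `PlanarSpectralCone`; its orbit functions
  are `T(R_θ H) = 𝔖(R_{θ+π/4} H) = Σ (-1)^k c_k e^{4ikθ}` (`orbit_pullBack`), and at the ray `-s > 0`
  the twist cancels: `(-1)^k c_k (-s)^k = c_k s^k` (`twist_cancel`).

References: Osterwalder–Schrader, *Axioms for Euclidean Green's functions* (1973), §4;
Glimm–Jaffe, *Quantum Physics* (1987), §6.1.
-/

noncomputable section

-- tree-known workaround (kept in every landed `Negative/*.lean` file):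
attribute [-instance] SimplexCategory.instFintypeToTypeOrderHomFinHAddNatLenOfNat

namespace Summit.QuantumFields.YangMills.Theorems.CurvatureBoostCovariance.BoostsInheritMirrors

open scoped BigOperators SchwartzMap InnerProductSpace ComplexConjugate
open MeasureTheory Filter Topology
open Literature.MathematicalPhysics.QuantumLattice Literature.MathematicalPhysics.AQFT
  Literature.MathematicalPhysics.QuantumFieldTheory
open Summit.QuantumFields.YangMills.Theorems.NPointIsotropy.Negative (E4)
open Summit.QuantumFields.YangMills.Theorems.CurvatureBoostCovariance.Negative
  (OSPackage Translations EightFrameRP PlanarCone isOffDiagonal_linActMulti)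

namespace RayPositivity

/-! ## Transport of the hypotheses to a pull-back family `n ↦ 𝔖ₙ ∘ (R ·)` -/

section PullBack

variable {S₁ : SchwingerFamily E4}

/-- E2 along `e₀` and translations on `⁰𝒮` are the premises of `OSReconstructionNoE1`. -/
theorem osReconstruction_of (hRP : S₁.toLabelled.IsReflectionPositive) (htr : Translations S₁) :
    OSReconstructionNoE1 S₁.toLabelled :=
  ⟨hRP, fun n _ a X hX => htr n a X hX⟩

/-- Translations on `⁰𝒮` transport to the pull-back by an isometry `R` (`R(x - a) = Rx - Ra`). -/
theorem translations_pullBack (htr : Translations S₁) (R : E4 ≃ₗᵢ[ℝ] E4) :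
    Translations (fun n => (S₁ n).comp (linActMulti R)) := by
  intro n a X hX
  have h : linActMulti R (translateMulti a X) = translateMulti (R a) (linActMulti R X) := by
    ext x; simp [linActMulti_apply, translateMulti_apply, map_sub]
  show S₁ n (linActMulti R (translateMulti a X)) = S₁ n (linActMulti R X)
  rw [h]
  exact htr n (R a) _ (isOffDiagonal_linActMulti hX R)

/-- E3 transports to the pull-back (the diagonal action commutes with label permutations). -/
theorem isSymmetric_pullBack (hsym : S₁.toLabelled.IsSymmetric) (R : E4 ≃ₗᵢ[ℝ] E4) :
    (SchwingerFamily.toLabelled fun n => (S₁ n).comp (linActMulti R)).IsSymmetric := by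
  intro n k π X hX
  have h : linActMulti R (permTest π X) = permTest π (linActMulti R X) := by
    ext x; simp [linActMulti_apply, permTest_apply, Function.comp_def]
  show S₁ n (linActMulti R (permTest π X)) = S₁ n (linActMulti R X)
  rw [h]
  exact hsym n k π _ (isOffDiagonal_linActMulti hX R)

/-- E0' transports to the pull-back (same Schwartz index and exponent, `α` replaced by `max α 0`;
the Schwartz norms are not increased by the diagonal isometry). -/
theorem hasLinearGrowth_pullBack (hlg : S₁.toLabelled.HasLinearGrowth) (R : E4 ≃ₗᵢ[ℝ] E4) :
    (SchwingerFamily.toLabelled fun n => (S₁ n).comp (linActMulti R)).HasLinearGrowth := by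
  intro _
  obtain ⟨s, α, β, hb⟩ := hlg Finset.univ
  refine ⟨s, max α 0, β, fun n k _ X hX => ?_⟩
  have h1 := hb n k (fun i => Finset.mem_univ _) (linActMulti R X) (isOffDiagonal_linActMulti hX R)
  simp only [SchwingerFamily.toLabelled_apply] at h1
  show ‖S₁ n (linActMulti R X)‖ ≤ _
  have hA : 0 ≤ (n.factorial : ℝ) ^ β := Real.rpow_nonneg (Nat.cast_nonneg _) _
  calc ‖S₁ n (linActMulti R X)‖
      ≤ α * (n.factorial : ℝ) ^ β * schwartzNorm (n * s) (linActMulti R X) := h1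
    _ ≤ max α 0 * (n.factorial : ℝ) ^ β * schwartzNorm (n * s) (linActMulti R X) :=
        mul_le_mul_of_nonneg_right (mul_le_mul_of_nonneg_right (le_max_left α 0) hA)
          (schwartzNorm_nonneg _ _)
    _ ≤ max α 0 * (n.factorial : ℝ) ^ β * schwartzNorm (n * s) X :=
        mul_le_mul_of_nonneg_left (schwartzNorm_linActMulti_le R _ X)
          (mul_nonneg (le_max_right α 0) hA)

/-- The `45°` frame `R_{π/4} = planeRot 0 (π/4)` of the `(x₀,x₁)`-plane. -/
local notation "R45" => planeRot (0 : Fin 3) (Real.pi / 4)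

/-- `R_{π/4} e₀ = (e₀ - e₁)/√2`. -/
theorem R45_e0 : R45 (EuclideanSpace.single 0 1) =
    (Real.sqrt 2 / 2) • EuclideanSpace.single 0 1 +
      (-(Real.sqrt 2 / 2)) • EuclideanSpace.single 1 1 := by
  ext j
  fin_cases j
  all_goals simp [planeRot_apply, Real.cos_pi_div_four, Real.sin_pi_div_four]

/-- `R_{π/4} e₁ = (e₀ + e₁)/√2`. -/
theorem R45_e1 : R45 (EuclideanSpace.single 1 1) =
    (Real.sqrt 2 / 2) • EuclideanSpace.single 0 1 + (Real.sqrt 2 / 2) • EuclideanSpace.single 1 1 := by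
  ext j
  fin_cases j
  all_goals simp [planeRot_apply, Real.cos_pi_div_four, Real.sin_pi_div_four]

/-- `(√2/2)² = 1/2`. -/
theorem sqrt_two_div_two_sq : (Real.sqrt 2 / 2) ^ 2 = 1 / 2 := by
  rw [div_pow, Real.sq_sqrt (by norm_num)]; norm_num

/-- **The `45°` pull-back is `e₀`-reflection positive** (`EightFrameRP` at the frame `R_{π/4}`,
time axis `(e₀ - e₁)/√2`, `a² = b² = 1/2`). -/
theorem isReflectionPositive_pullBack (h8 : EightFrameRP S₁) :
    (SchwingerFamily.toLabelled fun n => (S₁ n).comp (linActMulti R45)).IsReflectionPositive :=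
  h8 R45 (Real.sqrt 2 / 2) (-(Real.sqrt 2 / 2)) (by rw [neg_sq, sqrt_two_div_two_sq]; norm_num)
    (Or.inr (Or.inr (by rw [neg_sq]))) R45_e0

/-- **The eight frames transport to the `45°` pull-back**: `R_{π/4}` permutes the eight unit
normals of the mirror lines of the `(x₀,x₁)`-plane. -/
theorem eightFrameRP_pullBack (h8 : EightFrameRP S₁) :
    EightFrameRP (fun n => (S₁ n).comp (linActMulti R45)) := by
  intro R' a b hab hor hR'
  have hfam : (fun n => ((S₁ n).comp (linActMulti R45)).comp (linActMulti R')) =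
      fun n => (S₁ n).comp (linActMulti (R'.trans R45)) := by
    funext n; ext X
    show S₁ n (linActMulti R45 (linActMulti R' X)) = S₁ n (linActMulti (R'.trans R45) X)
    have h : linActMulti R45 (linActMulti R' X) = linActMulti (R'.trans R45) X := by
      ext x; simp [linActMulti_apply]
    rw [h]
  show (SchwingerFamily.toLabelled
    fun n => ((S₁ n).comp (linActMulti R45)).comp (linActMulti R')).IsReflectionPositive
  rw [hfam]
  refine h8 (R'.trans R45) (Real.sqrt 2 / 2 * (a + b)) (Real.sqrt 2 / 2 * (b - a)) ?_ ?_ ?_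
  · nlinarith [sqrt_two_div_two_sq]
  · rcases hor with ha | hb | hab2
    · right; right; subst ha; ring
    · right; right; subst hb; ring
    · have hprod : (a - b) * (a + b) = 0 := by nlinarith [hab2]
      rcases mul_eq_zero.1 hprod with h | h
      · right; left
        rw [show b - a = -(a - b) by ring, h]; simp
      · left; rw [h]; simp
  · rw [LinearIsometryEquiv.trans_apply, hR', map_add, map_smul, map_smul, R45_e0, R45_e1]
    ext j
    simp only [PiLp.add_apply, PiLp.smul_apply, PiLp.single_apply, smul_eq_mul]
    split_ifs <;> ring

/-- **The planar cone of the `45°` pull-back** from the hypothesis `PlanarSpectralCone` (the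
planar-cone theorem for eight-frame families, item stmt-QuantumFields-9664), fed with the
transported E0', E3, translations and eight frames. -/
theorem planarCone_pullBack
    (hPSC : Summit.QuantumFields.YangMills.Theses.MirrorModularBoosts.PlanarSpectralCone)
    (hlg : S₁.toLabelled.HasLinearGrowth) (hsym : S₁.toLabelled.IsSymmetric)
    (htr : Translations S₁) (h8 : EightFrameRP S₁) :
    PlanarCone (fun n => (S₁ n).comp (linActMulti R45)) :=
  hPSC (fun n => (S₁ n).comp (linActMulti R45)) (hasLinearGrowth_pullBack hlg R45)
    (isSymmetric_pullBack hsym R45) (translations_pullBack htr R45) (eightFrameRP_pullBack h8)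

/-- **Orbit functions of the `45°` pull-back**: shifting the angle by `π/4` twists the
coefficients by `(-1)^k`. -/
theorem orbit_pullBack {N : ℕ} (X : 𝓢((Fin N → E4), ℂ)) (K : ℕ) (c : ℤ → ℂ)
    (hc : ∀ θ : ℝ, S₁ N (linActMulti (planeRot (0 : Fin 3) θ) X) =
      ∑ k ∈ Finset.Icc (-(K : ℤ)) K, c k * Complex.exp (4 * (k : ℂ) * (θ : ℂ) * Complex.I))
    (θ : ℝ) :
    (fun n => (S₁ n).comp (linActMulti R45) : SchwingerFamily E4) N
        (linActMulti (planeRot (0 : Fin 3) θ) X) =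
      ∑ k ∈ Finset.Icc (-(K : ℤ)) K,
        ((-1) ^ k * c k) * Complex.exp (4 * (k : ℂ) * (θ : ℂ) * Complex.I) := by
  show S₁ N (linActMulti R45 (linActMulti (planeRot (0 : Fin 3) θ) X)) = _
  rw [linActMulti_planeRot_planeRot, hc]
  refine Finset.sum_congr rfl fun k _ => ?_
  have : ((Real.pi / 4 + θ : ℝ) : ℂ) = (θ : ℂ) + (Real.pi / 4 : ℝ) := by push_cast; ring
  rw [this, exp_shift_quarter]
  ring

end PullBack

/-! ## The axis rays for a general family, from boosted vectors -/

/-- **The orbit function is a matrix element** for small angles: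
`𝔖(R_θ H) = ⟪Ψ_{R_{-θ}F}, Ψ_{R_θ G}⟫` for `H = ΘF* ⊗ G` (`inner_fieldVec_fieldVec` and
`R_θ(ΘF* ⊗ G) = Θ(R_{-θ}F)* ⊗ R_θ G`). -/
theorem orbit_eq_inner {S' : SchwingerFamily E4} (h' : OSReconstructionNoE1 S'.toLabelled)
    {n m : ℕ} {F : 𝓢((Fin n → E4), ℂ)} {G : 𝓢((Fin m → E4), ℂ)} {H : 𝓢((Fin (n + m) → E4), ℂ)}
    (hH : IsAppendTensorOf H (osAdjoint F) G) (θ : ℝ)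
    (hθF : IsTimeOrdered (linActMulti (planeRot (0 : Fin 3) (-θ)) F))
    (hθG : IsTimeOrdered (linActMulti (planeRot (0 : Fin 3) θ) G)) :
    S' (n + m) (linActMulti (planeRot (0 : Fin 3) θ) H) =
      ⟪h'.fieldVec n (fun _ => ()) _ hθF, h'.fieldVec m (fun _ => ()) _ hθG⟫_ℂ := by
  rw [h'.inner_fieldVec_fieldVec (fun _ => ()) (fun _ => ()) hθF hθG
    (isAppendTensorOf_linActMulti_planeRot hH θ)]
  rfl

/-- **The axis rays (`s > 0`) for a general family with boosted vectors.**  Under the boosted-vector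
hypothesis (the statement of `stub_planarBoostVectors`), for a family `S'` with E2 along `e₀` and
translations (`h'`), E0', E3, the eight frames and the planar cone, and the four doubled orbit
trigonometric polynomials: the pencil is real and `≥ 0` at every `s > 0`. -/
theorem axis_half
    (hPBV : ∀ (S₁ : SchwingerFamily E4) (h : OSReconstructionNoE1 S₁.toLabelled),
      S₁.toLabelled.HasLinearGrowth → S₁.toLabelled.IsSymmetric → EightFrameRP S₁ → PlanarCone S₁ →
      ∀ (n : ℕ) (F : SchwartzMap (Fin n → E4) ℂ), IsTimeOrdered F →
        HasCompactSupport (F : (Fin n → E4) → ℂ) →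
        ∃ ε : ℝ, 0 < ε ∧ ∃ (V : ℂ → h.Hilbert) (C N : ℝ),
          DifferentiableOn ℂ V {θ : ℂ | |θ.re| < ε} ∧
          (∀ θ : ℂ, |θ.re| < ε → ‖V θ‖ ≤ C * Real.exp (N * |θ.im|)) ∧
          ∀ θ : ℝ, |θ| < ε → ∀ hθ : IsTimeOrdered (linActMulti (planeRot (0 : Fin 3) θ) F),
            V θ = h.fieldVec n (fun _ => ()) (linActMulti (planeRot (0 : Fin 3) θ) F) hθ)
    {S' : SchwingerFamily E4}
    (h' : OSReconstructionNoE1 S'.toLabelled) (hlg : S'.toLabelled.HasLinearGrowth)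
    (hsym : S'.toLabelled.IsSymmetric) (h8 : EightFrameRP S') (hC : PlanarCone S')
    {n m : ℕ} {F : 𝓢((Fin n → E4), ℂ)} {G : 𝓢((Fin m → E4), ℂ)}
    (hF : IsTimeOrdered F) (hG : IsTimeOrdered G)
    (hFc : HasCompactSupport (F : (Fin n → E4) → ℂ)) (hGc : HasCompactSupport (G : (Fin m → E4) → ℂ))
    {HFF : 𝓢((Fin (n + n) → E4), ℂ)} {HFG : 𝓢((Fin (n + m) → E4), ℂ)}
    {HGF : 𝓢((Fin (m + n) → E4), ℂ)} {HGG : 𝓢((Fin (m + m) → E4), ℂ)}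
    (hHFF : IsAppendTensorOf HFF (osAdjoint F) F) (hHFG : IsAppendTensorOf HFG (osAdjoint F) G)
    (hHGF : IsAppendTensorOf HGF (osAdjoint G) F) (hHGG : IsAppendTensorOf HGG (osAdjoint G) G)
    (Kp Kq Kq' Kr : ℕ) (p q q' r : ℤ → ℂ)
    (hp : ∀ θ : ℝ, S' (n + n) (linActMulti (planeRot (0 : Fin 3) θ) HFF) =
      ∑ k ∈ Finset.Icc (-(Kp : ℤ)) Kp, p k * Complex.exp (4 * (k : ℂ) * (θ : ℂ) * Complex.I))
    (hq : ∀ θ : ℝ, S' (n + m) (linActMulti (planeRot (0 : Fin 3) θ) HFG) =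
      ∑ k ∈ Finset.Icc (-(Kq : ℤ)) Kq, q k * Complex.exp (4 * (k : ℂ) * (θ : ℂ) * Complex.I))
    (hq' : ∀ θ : ℝ, S' (m + n) (linActMulti (planeRot (0 : Fin 3) θ) HGF) =
      ∑ k ∈ Finset.Icc (-(Kq' : ℤ)) Kq', q' k * Complex.exp (4 * (k : ℂ) * (θ : ℂ) * Complex.I))
    (hr : ∀ θ : ℝ, S' (m + m) (linActMulti (planeRot (0 : Fin 3) θ) HGG) =
      ∑ k ∈ Finset.Icc (-(Kr : ℤ)) Kr, r k * Complex.exp (4 * (k : ℂ) * (θ : ℂ) * Complex.I))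
    (s : ℝ) (hs : 0 < s) (v w : ℂ) :
    (fun z : ℂ => 0 ≤ z.re ∧ z.im = 0)
      ((∑ k ∈ Finset.Icc (-(Kp : ℤ)) Kp, starRingEnd ℂ v * v * (p k * (s : ℂ) ^ k)) +
      (∑ k ∈ Finset.Icc (-(Kq : ℤ)) Kq, starRingEnd ℂ v * w * (q k * (s : ℂ) ^ k)) +
      (∑ k ∈ Finset.Icc (-(Kq' : ℤ)) Kq', starRingEnd ℂ w * v * (q' k * (s : ℂ) ^ k)) +
      (∑ k ∈ Finset.Icc (-(Kr : ℤ)) Kr, starRingEnd ℂ w * w * (r k * (s : ℂ) ^ k))) := by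
  obtain ⟨εF, hεF, VF, CF, NF, hVFd, -, hVF⟩ := hPBV S' h' hlg hsym h8 hC n F hF hFc
  obtain ⟨εG, hεG, VG, CG, NG, hVGd, -, hVG⟩ := hPBV S' h' hlg hsym h8 hC m G hG hGc
  obtain ⟨δF, hδF, hTF⟩ := exists_isTimeOrdered_planeRot hF hFc
  obtain ⟨δG, hδG, hTG⟩ := exists_isTimeOrdered_planeRot hG hGc
  set ε : ℝ := min (min εF εG) (min δF δG) with hε_def
  have hε : 0 < ε := lt_min (lt_min hεF hεG) (lt_min hδF hδG)
  have hεF' : ε ≤ εF := (min_le_left _ _).trans (min_le_left _ _)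
  have hεG' : ε ≤ εG := (min_le_left _ _).trans (min_le_right _ _)
  have hδF' : ε ≤ δF := (min_le_right _ _).trans (min_le_left _ _)
  have hδG' : ε ≤ δG := (min_le_right _ _).trans (min_le_right _ _)
  have hVFd' : DifferentiableOn ℂ VF {θ : ℂ | |θ.re| < ε} :=
    hVFd.mono fun θ (hθ : |θ.re| < ε) => lt_of_lt_of_le hθ hεF'
  have hVGd' : DifferentiableOn ℂ VG {θ : ℂ | |θ.re| < ε} :=
    hVGd.mono fun θ (hθ : |θ.re| < ε) => lt_of_lt_of_le hθ hεG'
  -- time-ordering of the rotated factors and the identification with the boosted vectors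
  have tF : ∀ θ : ℝ, |θ| < ε → IsTimeOrdered (linActMulti (planeRot (0 : Fin 3) θ) F) :=
    fun θ hθ => hTF θ (lt_of_lt_of_le hθ hδF')
  have tG : ∀ θ : ℝ, |θ| < ε → IsTimeOrdered (linActMulti (planeRot (0 : Fin 3) θ) G) :=
    fun θ hθ => hTG θ (lt_of_lt_of_le hθ hδG')
  have nabs : ∀ θ : ℝ, |θ| < ε → |(-θ)| < ε := fun θ hθ => by rwa [abs_neg]
  have eF : ∀ (θ : ℝ) (hθ : |θ| < ε),
      VF (-(θ : ℂ)) = h'.fieldVec n (fun _ => ()) _ (tF (-θ) (nabs θ hθ)) := fun θ hθ => by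
    have := hVF (-θ) (lt_of_lt_of_le (nabs θ hθ) hεF') (tF (-θ) (nabs θ hθ))
    push_cast at this
    exact this
  have eF' : ∀ (θ : ℝ) (hθ : |θ| < ε), VF θ = h'.fieldVec n (fun _ => ()) _ (tF θ hθ) :=
    fun θ hθ => hVF θ (lt_of_lt_of_le hθ hεF') (tF θ hθ)
  have eG : ∀ (θ : ℝ) (hθ : |θ| < ε),
      VG (-(θ : ℂ)) = h'.fieldVec m (fun _ => ()) _ (tG (-θ) (nabs θ hθ)) := fun θ hθ => by
    have := hVG (-θ) (lt_of_lt_of_le (nabs θ hθ) hεG') (tG (-θ) (nabs θ hθ))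
    push_cast at this
    exact this
  have eG' : ∀ (θ : ℝ) (hθ : |θ| < ε), VG θ = h'.fieldVec m (fun _ => ()) _ (tG θ hθ) :=
    fun θ hθ => hVG θ (lt_of_lt_of_le hθ hεG') (tG θ hθ)
  -- the four real-segment Gram identities
  have ip : ∀ θ : ℝ, |θ| < ε → ⟪VF (-(θ : ℂ)), VF θ⟫_ℂ =
      ∑ k ∈ Finset.Icc (-(Kp : ℤ)) Kp, p k * Complex.exp (4 * (k : ℂ) * (θ : ℂ) * Complex.I) :=
    fun θ hθ => by rw [eF θ hθ, eF' θ hθ, ← orbit_eq_inner h' hHFF θ, hp θ]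
  have iq : ∀ θ : ℝ, |θ| < ε → ⟪VF (-(θ : ℂ)), VG θ⟫_ℂ =
      ∑ k ∈ Finset.Icc (-(Kq : ℤ)) Kq, q k * Complex.exp (4 * (k : ℂ) * (θ : ℂ) * Complex.I) :=
    fun θ hθ => by rw [eF θ hθ, eG' θ hθ, ← orbit_eq_inner h' hHFG θ, hq θ]
  have iq' : ∀ θ : ℝ, |θ| < ε → ⟪VG (-(θ : ℂ)), VF θ⟫_ℂ =
      ∑ k ∈ Finset.Icc (-(Kq' : ℤ)) Kq', q' k * Complex.exp (4 * (k : ℂ) * (θ : ℂ) * Complex.I) :=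
    fun θ hθ => by rw [eG θ hθ, eF' θ hθ, ← orbit_eq_inner h' hHGF θ, hq' θ]
  have ir : ∀ θ : ℝ, |θ| < ε → ⟪VG (-(θ : ℂ)), VG θ⟫_ℂ =
      ∑ k ∈ Finset.Icc (-(Kr : ℤ)) Kr, r k * Complex.exp (4 * (k : ℂ) * (θ : ℂ) * Complex.I) :=
    fun θ hθ => by rw [eG θ hθ, eG' θ hθ, ← orbit_eq_inner h' hHGG θ, hr θ]
  exact stub_rayPositivityCore h'.Hilbert ε hε VF VG hVFd' hVGd' Kp Kq Kq' Kr p q q' r ip iq iq' ir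
    s hs v w

end RayPositivity

open RayPositivity

/-- **Stub 4 — boosts inherit the mirrors: ray positivity of the doubled pencils** (closed MODULO
the registered input `stub_planarBoostVectors`, whose statement is the first hypothesis).  Axis
rays `s > 0`: `axis_half` for `S₁` itself; diagonal rays `s < 0`: `axis_half` for the `45°`
pull-back `𝔖 ∘ (R_{π/4} ·)` (reflection positive by `EightFrameRP`, planar cone by
`PlanarSpectralCone` and the transported E0', E3, translations, eight frames), whose orbit
coefficients are `(-1)^k c_k`, evaluated at `-s > 0`.  Registered signature of the skeleton
`Cruxes/CurvatureBoostCovariance/Lines/boosts_inherit_mirrors.lean`, verbatim. -/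
theorem stub_rayPositivity :
    open Literature.MathematicalPhysics.QuantumLattice Literature.MathematicalPhysics.AQFT
      Literature.MathematicalPhysics.QuantumFieldTheory
      Summit.QuantumFields.YangMills.Theorems.CurvatureBoostCovariance.Negative
      Summit.QuantumFields.YangMills.Theorems.NPointIsotropy.Negative in
    (∀ (S₁ : SchwingerFamily E4) (h : OSReconstructionNoE1 S₁.toLabelled),
      S₁.toLabelled.HasLinearGrowth → S₁.toLabelled.IsSymmetric → EightFrameRP S₁ → PlanarCone S₁ →
      ∀ (n : ℕ) (F : SchwartzMap (Fin n → E4) ℂ), IsTimeOrdered F →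
        HasCompactSupport (F : (Fin n → E4) → ℂ) →
        ∃ ε : ℝ, 0 < ε ∧ ∃ (V : ℂ → h.Hilbert) (C N : ℝ),
          DifferentiableOn ℂ V {θ : ℂ | |θ.re| < ε} ∧
          (∀ θ : ℂ, |θ.re| < ε → ‖V θ‖ ≤ C * Real.exp (N * |θ.im|)) ∧
          ∀ θ : ℝ, |θ| < ε → ∀ hθ : IsTimeOrdered (linActMulti (planeRot (0 : Fin 3) θ) F),
            V θ = h.fieldVec n (fun _ => ()) (linActMulti (planeRot (0 : Fin 3) θ) F) hθ) →
    ∀ (S₁ : SchwingerFamily E4), OSPackage S₁ → Translations S₁ → EightFrameRP S₁ → PlanarCone S₁ →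
      Summit.QuantumFields.YangMills.Theses.MirrorModularBoosts.PlanarSpectralCone →
      ∀ (n m : ℕ) (F : SchwartzMap (Fin n → E4) ℂ) (G : SchwartzMap (Fin m → E4) ℂ),
        IsTimeOrdered F → IsTimeOrdered G →
        HasCompactSupport (F : (Fin n → E4) → ℂ) → HasCompactSupport (G : (Fin m → E4) → ℂ) →
        ∀ (HFF : SchwartzMap (Fin (n + n) → E4) ℂ) (HFG : SchwartzMap (Fin (n + m) → E4) ℂ)
          (HGF : SchwartzMap (Fin (m + n) → E4) ℂ) (HGG : SchwartzMap (Fin (m + m) → E4) ℂ),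
          IsAppendTensorOf HFF (osAdjoint F) F → IsAppendTensorOf HFG (osAdjoint F) G →
          IsAppendTensorOf HGF (osAdjoint G) F → IsAppendTensorOf HGG (osAdjoint G) G →
        ∀ (Kp Kq Kq' Kr : ℕ) (p q q' r : ℤ → ℂ),
          (∀ θ : ℝ, S₁ (n + n) (linActMulti (planeRot (0 : Fin 3) θ) HFF) =
            ∑ k ∈ Finset.Icc (-(Kp : ℤ)) Kp, p k * Complex.exp (4 * (k : ℂ) * (θ : ℂ) * Complex.I)) →
          (∀ θ : ℝ, S₁ (n + m) (linActMulti (planeRot (0 : Fin 3) θ) HFG) =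
            ∑ k ∈ Finset.Icc (-(Kq : ℤ)) Kq, q k * Complex.exp (4 * (k : ℂ) * (θ : ℂ) * Complex.I)) →
          (∀ θ : ℝ, S₁ (m + n) (linActMulti (planeRot (0 : Fin 3) θ) HGF) =
            ∑ k ∈ Finset.Icc (-(Kq' : ℤ)) Kq', q' k * Complex.exp (4 * (k : ℂ) * (θ : ℂ) * Complex.I)) →
          (∀ θ : ℝ, S₁ (m + m) (linActMulti (planeRot (0 : Fin 3) θ) HGG) =
            ∑ k ∈ Finset.Icc (-(Kr : ℤ)) Kr, r k * Complex.exp (4 * (k : ℂ) * (θ : ℂ) * Complex.I)) →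
        ∀ s : ℝ, s ≠ 0 → ∀ v w : ℂ,
          (fun z : ℂ => 0 ≤ z.re ∧ z.im = 0)
            ((∑ k ∈ Finset.Icc (-(Kp : ℤ)) Kp, starRingEnd ℂ v * v * (p k * (s : ℂ) ^ k)) +
            (∑ k ∈ Finset.Icc (-(Kq : ℤ)) Kq, starRingEnd ℂ v * w * (q k * (s : ℂ) ^ k)) +
            (∑ k ∈ Finset.Icc (-(Kq' : ℤ)) Kq', starRingEnd ℂ w * v * (q' k * (s : ℂ) ^ k)) +
            (∑ k ∈ Finset.Icc (-(Kr : ℤ)) Kr, starRingEnd ℂ w * w * (r k * (s : ℂ) ^ k))) := by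
  intro hPBV S₁ hOS htr h8 hC hPSC n m F G hF hG hFc hGc HFF HFG HGF HGG hHFF hHFG hHGF hHGG
    Kp Kq Kq' Kr p q q' r hp hq hq' hr s hs v w
  obtain ⟨-, -, hlg, hRP, hsym, -⟩ := hOS
  rcases lt_or_gt_of_ne hs with hneg | hpos
  · -- the diagonal rays `s < 0`: the `45°` pull-back at `-s > 0`
    have hT : OSReconstructionNoE1 (SchwingerFamily.toLabelled
        fun k => (S₁ k).comp (linActMulti (planeRot (0 : Fin 3) (Real.pi / 4)))) :=
      osReconstruction_of (isReflectionPositive_pullBack h8) (translations_pullBack htr _)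
    have res := axis_half hPBV hT (hasLinearGrowth_pullBack hlg _) (isSymmetric_pullBack hsym _)
      (eightFrameRP_pullBack h8) (planarCone_pullBack hPSC hlg hsym htr h8) hF hG hFc hGc
      hHFF hHFG hHGF hHGG Kp Kq Kq' Kr (fun k => (-1) ^ k * p k) (fun k => (-1) ^ k * q k)
      (fun k => (-1) ^ k * q' k) (fun k => (-1) ^ k * r k)
      (orbit_pullBack HFF Kp p hp) (orbit_pullBack HFG Kq q hq) (orbit_pullBack HGF Kq' q' hq')
      (orbit_pullBack HGG Kr r hr) (-s) (by linarith) v w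
    simp only [twist_cancel] at res
    exact res
  · -- the axis rays `s > 0`
    exact axis_half hPBV (osReconstruction_of hRP htr) hlg hsym h8 hC hF hG hFc hGc hHFF hHFG hHGF
      hHGG Kp Kq Kq' Kr p q q' r hp hq hq' hr s hpos v w

end Summit.QuantumFields.YangMills.Theorems.CurvatureBoostCovariance.BoostsInheritMirrors

end
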